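import Summits.Ventures.PercRepro.ProfileGapMonoColoopBand

/-!
# PercRepro — THE THRESHOLD FAMILY `(I_t)` AND THE COLOOP BAND CASE `u = q + 1` (p5, gen 23;
`proofs/P5-GM1.md` §21; announced INBOX 11422)

For a finite matroid `N`, `q ≥ 1` and a threshold `t`, the THRESHOLD INEQUALITY `(I_t)` reads
`q · #{S : ρ(S) = q, ρ(E∖S) ≥ t} ≥ Σ_{B : ρ(B) = q−1, ρ(E∖B) ≥ t+1} ρ(E∖B)`.
* at `t = q − 1` it is the row `(q−1, q)` of the profile (`thresholdIneq_iff_row`);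
* at `t = q + 1` it is `(★_q)` at the level `u = q + 1` for `M ∖ z` (`starQ_succ_iff_thresholdIneq`) — the one
  coloop piece of the hard rule's dispatch with no reduction (`ProfileGapMonoColoopBand`, §18).
Its deletion gap `Φ_t(N) := q · #T_t(N) − Σ_{L_t(N)} ρ(E∖B)` is, on every matroid on `≤ 8` elements (exhaustive,
engine catalogue), non-increasing under the deletion of SOME point (`0 / 5,939` instances at `t = q + 1`); at
`t ≤ q` every non-coloop point qualifies (`0` failures), at `t = q + 1` not every one (5 instances on 8 elements,
`q = 3`: the points of a large series class are bad, the others good).  `DelMonoT` names the per-point statement,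
`DelMonoRuleT` the rule «one such point per matroid» (CONJECTURES, NOT asserted here), and
`thresholdIneq_of_delMonoRuleT` is the induction on `#E` that turns the rule into `(I_t)` on every finite
matroid; `gapMonoQ_of_coloop_succ_of_rule` is `(GM)_q` at a coloop at the level `u = q + 1` from the rule at
`t = q + 1` (with the trivial row `(q, q)` of `M ∖ z`).

* `thresholdSum`, `ThresholdIneq`, **`starQ_succ_iff_thresholdIneq`**, **`thresholdIneq_iff_row`**,
  `DelMonoT` (conjecture def), `DelMonoRuleT` (conjecture def), `thresholdIneq_of_delMonoT`,
  `thresholdIneq_of_card_eq_zero`, **`thresholdIneq_of_delMonoRuleT`**, **`gapMonoQ_of_coloop_succ_of_rule`**.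
-/

open scoped Matroid

namespace PercRepro.Cogirth

open Finset ThmH Skew Shadow Profile

variable {α : Type} [DecidableEq α] {M : Matroid α} [M.Finite]

section Threshold

variable {N : Matroid α} [N.Finite] {q t : ℕ}

/-- The threshold demand of the rank-`(q−1)` sets of `N`: `Σ_{B : ρ(B) = q−1, ρ(E∖B) ≥ t+1} ρ(E∖B)`. -/
noncomputable def thresholdSum (N : Matroid α) [N.Finite] (q t : ℕ) : ℕ :=
  ∑ B ∈ Rq N (q - 1), (if t + 1 ≤ rk N (gr N \ B) then rk N (gr N \ B) else 0)

/-- **The threshold inequality `(I_t)`**: `Σ_{B : ρ(B) = q−1, ρ(E∖B) ≥ t+1} ρ(E∖B) ≤ q · #{S : ρ(S) = q, ρ(E∖S) ≥ t}`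
(the co-rank-`t` rank-`q` sets are `levelSetCoQ N t q`). -/
def ThresholdIneq (N : Matroid α) [N.Finite] (q t : ℕ) : Prop :=
  thresholdSum N q t ≤ q * (levelSetCoQ N t q).card

/-- `C(q, q−1) = q` for `1 ≤ q`. -/
theorem choose_pred_self (hq : 1 ≤ q) : q.choose (q - 1) = q := by
  obtain ⟨q', rfl⟩ : ∃ q', q = q' + 1 := ⟨q - 1, by omega⟩
  simp only [Nat.add_sub_cancel, Nat.choose_succ_self_right]

/-- **`(★_q)` at the level `u = q + 1` is `(I_{q+1})` of `M ∖ z`** (`1 ≤ q`): in the band form the weights are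
`C(m', 1) = m'` and `C(q, q−1) = q`. -/
theorem starQ_succ_iff_thresholdIneq {z : α} (hq : 1 ≤ q) :
    StarQ M z q (q + 1) ↔ ThresholdIneq (M ＼ ({z} : Set α)) q (q + 1) := by
  rw [starQ_iff_band (by omega : q < q + 1)]
  unfold ThresholdIneq thresholdSum
  have h1 : q + 1 - q = 1 := by omega
  have h2 : q + 1 - 1 = q := by omega
  simp only [h1, h2, choose_pred_self hq, Nat.choose_one_right]

/-- **`(I_{q−1})` is the row `(q − 1, q)` of the profile** (`1 ≤ q`): the demand at the level `q` of a rank-`(q−1)`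
set is `[q ≤ ρ(E∖B)] · C(ρ(E∖B), 1) = [q ≤ ρ(E∖B)] · ρ(E∖B)` and `C(q, q−1) = q`. -/
theorem thresholdIneq_iff_row (hq : 1 ≤ q) : ThresholdIneq N q (q - 1) ↔ ProfileIneqMinusQ N (q - 1) q := by
  unfold ThresholdIneq thresholdSum ProfileIneqMinusQ demand
  have h1 : q - 1 + 1 = q := by omega
  have h2 : q - (q - 1) = 1 := by omega
  simp only [h1, h2, choose_pred_self hq, Nat.choose_one_right]

end Threshold

section DelMono

variable {N : Matroid α} [N.Finite] {z : α} {q t : ℕ}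

/-- **Deletion monotonicity of the threshold gap at `z`** (NOT asserted; data: true at every non-coloop `z` for
`t ≤ q` and at some point of every matroid for `t = q + 1`, on all matroids on `≤ 8` elements):
`Φ_t(N ∖ z) ≤ Φ_t(N)` with `Φ_t(N) = q · #{S : ρ(S) = q, ρ(E∖S) ≥ t} − thresholdSum N q t`, written without
subtraction. -/
def DelMonoT (N : Matroid α) [N.Finite] (z : α) (q t : ℕ) : Prop :=
  thresholdSum N q t + q * (levelSetCoQ (N ＼ ({z} : Set α)) t q).card ≤
    thresholdSum (N ＼ ({z} : Set α)) q t + q * (levelSetCoQ N t q).card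

/-- **The rule**: every finite matroid on a nonempty ground set has a deletion-monotone point for `(q, t)`
(a CONJECTURE, NOT asserted; exhaustively true on `≤ 8` elements for `t ≤ q + 1`, where for `t ≤ q` every
non-coloop point qualifies; on the free matroid every point has `Φ_t = 0` on both sides). -/
def DelMonoRuleT (α : Type) [DecidableEq α] (q t : ℕ) : Prop :=
  ∀ (N : Matroid α) [N.Finite], (gr N).Nonempty → ∃ z ∈ gr N, DelMonoT N z q t

/-- **The induction step at a deletion-monotone point.** -/
theorem thresholdIneq_of_delMonoT (h : DelMonoT N z q t) (h' : ThresholdIneq (N ＼ ({z} : Set α)) q t) :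
    ThresholdIneq N q t := by
  unfold DelMonoT at h
  unfold ThresholdIneq at h' ⊢
  omega

/-- `(I_t)` on the empty ground set: every rank-`(q−1)` set has an empty complement, of rank `0 < t + 1`. -/
theorem thresholdIneq_of_card_eq_zero (hN : (gr N).card = 0) : ThresholdIneq N q t := by
  unfold ThresholdIneq thresholdSum
  have hgr : gr N = ∅ := card_eq_zero.1 hN
  have hzero : ∀ B ∈ Rq N (q - 1), (if t + 1 ≤ rk N (gr N \ B) then rk N (gr N \ B) else 0) = 0 := by
    intro B _
    have hle : rk N (gr N \ B) ≤ (gr N \ B).card := rk_le_card _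
    have hcard : (gr N \ B).card = 0 := by rw [hgr, empty_sdiff, card_empty]
    rw [if_neg (by omega)]
  rw [sum_eq_zero hzero]
  exact Nat.zero_le _

/-- **`(I_t)` on every finite matroid from the rule**: strong induction on `#E`, deleting the rule's point. -/
theorem thresholdIneq_of_delMonoRuleT (h : DelMonoRuleT α q t) (M : Matroid α) [M.Finite] :
    ThresholdIneq M q t := by
  suffices hh : ∀ n : ℕ, ∀ (N : Matroid α) [N.Finite], (gr N).card = n → ThresholdIneq N q t from
    hh _ M rfl
  intro n
  induction n using Nat.strong_induction_on with
  | _ n ih =>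
  intro N _ hN
  rcases (gr N).eq_empty_or_nonempty with hempty | hne
  · exact thresholdIneq_of_card_eq_zero (by rw [hempty, card_empty])
  · obtain ⟨z, hz, hdm⟩ := h N hne
    have hlt : ((gr N).erase z).card < n := by rw [← hN]; exact card_erase_lt_of_mem hz
    exact thresholdIneq_of_delMonoT hdm (ih _ hlt (N ＼ ({z} : Set α)) (by rw [gr_delete']))

end DelMono

section ColoopSucc

variable {z : α} {q : ℕ}

/-- **`(GM)_q` at a coloop at the level `u = q + 1` from the rule at `t = q + 1`** (`1 ≤ q`): the row `(q, q)` of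
`M ∖ z` is the trivial row `profileIneqMinusQ_self`, and `(★_q)` at `u = q + 1` is `(I_{q+1})` of `M ∖ z`. -/
theorem gapMonoQ_of_coloop_succ_of_rule (hz : z ∈ gr M) (hzc : rk M ((gr M).erase z) + 1 = rk M (gr M))
    (hq : 1 ≤ q) (h : DelMonoRuleT α q (q + 1)) : GapMonoQ M z q (q + 1) := by
  have hrow : ProfileIneqMinusQ (M ＼ ({z} : Set α)) q (q + 1 - 1) := by
    rw [Nat.add_sub_cancel]
    exact profileIneqMinusQ_self _ q
  exact gapMonoQ_of_coloop_of_starQ hz hzc hq (by omega) hrow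
    ((starQ_succ_iff_thresholdIneq hq).2 (thresholdIneq_of_delMonoRuleT h _))

end ColoopSucc

end PercRepro.Cogirth
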